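import Summits.ResolutionOfSingularities.ResolutionOfSingularities.Theorems.FrobeniusLadderFInjectiveMacaulayficationFCentreE1RungZero
import Summits.ResolutionOfSingularities.ResolutionOfSingularities.Theorems.FrobeniusLadderFInjectiveMacaulayficationP2d4F5Specimen
import HarnessLib

/-!
# THE SPECIMEN PACKAGE OF P2d4B = `z² + x²z + y³ + u³ + t⁵` (char 2, `d = 4`): prime, vertex closed / singular / isolated / of dimension 4 / CM, NOT FULL
# (crux `FInjectiveMacaulayfication` stmt-ResolutionOfSingularities-15315, chain w45a; res-L1-w45a-plan-1 RULING R18.1 (4) «sibling positive kernel rows: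
# then P2d4B if certified»; template = res-L1-w45a-stub-1's `FCentreE1RungZero` /
# `FCentreE1ChartWitness` §4 for P2d4C; seat res-L1-w45a-stub-2 g7)

[OURS · L1 W4.5a] Support file (`--supports stmt-ResolutionOfSingularities-15315 --as helper`); def-free, unconditional; replaces the role of NO printed
item; NOT a statement of the manuscript; AI-written (AI review is weaker than expert review).

`X 0 = x`, `X 1 = y`, `X 2 = u`, `X 3 = t`, `X 4 = z`; `f = z² + x²z + y³ + u³ + t⁵`; `v` = the origin of `X = Spec k[X]/(f)`, `char k = 2`.
* §1 `pderiv_four_f` (`∂_z f = x²`), `pderiv_one_f`/`pderiv_two_f` (`= y², u²`), `pderiv_three_f` (`= t⁴`), `constantCoeff_f`, ★ `prime_f` (Eisenstein-type at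
  `(x,y,u,t) = (0,1,1,0)`: `T² + C(x²)T + C(y³+u³+t⁵)`, `∂/∂y = 3y² = 1 ≠ 0` there), `regular_off_vertex` (Jacobian off `𝔪`), `isIntegral_p2d4b`;
* §2 the germ binders at `v`: `isClosed_vertex`, `vertex_not_mem_regularLocus`, `ringKrullDim_stalk_vertex = 4`, `regular_of_ne_vertex` / `regular_off_closedPoint_vertex`
  (ISOLATED), `cmCl_Spec_stalk_vertex`;
* §3 ★ `p2d4b_vertex_not_fullCl : ¬ FullCl 2 𝒪_{X,v}` — `f = z·z + x²·z + y²·y + u²·u + t²·t³ ∈ 𝔪^{[2]}` (Fedder necessity, p603303).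
[folklore mathematics, OURS as a certificate; cite: Hartshorne1977, I Thm. 5.1; Matsumura1987, Thm. 17.4; Fedder1983, Prop. 1.7]
-/

-- single-problem summit: the doubled namespace component is forced
set_option linter.dupNamespace false

noncomputable section

open AlgebraicGeometry CategoryTheory Literature.AlgebraicGeometry.Resolution TopologicalSpace IsLocalRing MvPolynomial

namespace Summit.ResolutionOfSingularities.ResolutionOfSingularities.Theorems.FInjectiveMacaulayfication.P2d4BSpecimen

open Summit.ResolutionOfSingularities.ResolutionOfSingularities.Theorems.FInjectiveMacaulayfication
open SliceableCentre GermForm GermOfGlobalBlowup FCentreE1RungZero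

/-! ## §1 Derivatives, primality, regularity off the vertex -/

/-- `∂f/∂z = 2z + x²` (`= x²` in characteristic 2). [folklore] -/
theorem pderiv_four_f (k : Type) [Field k] [CharP k 2] (f : MvPolynomial (Fin 5) k)
    (hf : f = X 4 ^ 2 + X 0 ^ 2 * X 4 + X 1 ^ 3 + X 2 ^ 3 + X 3 ^ 5) : pderiv 4 f = X 0 ^ 2 := by
  have h2 : (2 : MvPolynomial (Fin 5) k) = 0 := (FermatCubicConeChar2.two_three k (n := 5)).1
  rw [hf]
  simp only [map_add, Derivation.leibniz, pderiv_pow, pderiv_X_self, pderiv_X_of_ne (show (0 : Fin 5) ≠ 4 by decide),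
    pderiv_X_of_ne (show (1 : Fin 5) ≠ 4 by decide), pderiv_X_of_ne (show (2 : Fin 5) ≠ 4 by decide),
    pderiv_X_of_ne (show (3 : Fin 5) ≠ 4 by decide), smul_eq_mul, mul_zero, mul_one, add_zero]
  push_cast
  rw [h2]
  ring

/-- `3 = 1` in a ring of characteristic 2 polynomials. [folklore] -/
theorem three_eq_one (k : Type) [Field k] [CharP k 2] : (3 : MvPolynomial (Fin 5) k) = 1 :=
  (FermatCubicConeChar2.two_three k (n := 5)).2

/-- `∂f/∂y = 3y²` (`= y²` in characteristic 2). [folklore] -/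
theorem pderiv_one_f (k : Type) [Field k] [CharP k 2] (f : MvPolynomial (Fin 5) k)
    (hf : f = X 4 ^ 2 + X 0 ^ 2 * X 4 + X 1 ^ 3 + X 2 ^ 3 + X 3 ^ 5) : pderiv 1 f = X 1 ^ 2 := by
  have h3 := three_eq_one k
  rw [hf]
  simp only [map_add, Derivation.leibniz, pderiv_pow, pderiv_X_self, smul_eq_mul, pderiv_X_of_ne (show (4 : Fin 5) ≠ 1 by decide),
    pderiv_X_of_ne (show (0 : Fin 5) ≠ 1 by decide), pderiv_X_of_ne (show (2 : Fin 5) ≠ 1 by decide),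
    pderiv_X_of_ne (show (3 : Fin 5) ≠ 1 by decide), mul_zero, mul_one, zero_add, add_zero]
  push_cast
  rw [h3]
  ring

/-- `∂f/∂u = 3u²` (`= u²` in characteristic 2). [folklore] -/
theorem pderiv_two_f (k : Type) [Field k] [CharP k 2] (f : MvPolynomial (Fin 5) k)
    (hf : f = X 4 ^ 2 + X 0 ^ 2 * X 4 + X 1 ^ 3 + X 2 ^ 3 + X 3 ^ 5) : pderiv 2 f = X 2 ^ 2 := by
  have h3 := three_eq_one k
  rw [hf]
  simp only [map_add, Derivation.leibniz, pderiv_pow, pderiv_X_self, smul_eq_mul, pderiv_X_of_ne (show (4 : Fin 5) ≠ 2 by decide),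
    pderiv_X_of_ne (show (0 : Fin 5) ≠ 2 by decide), pderiv_X_of_ne (show (1 : Fin 5) ≠ 2 by decide),
    pderiv_X_of_ne (show (3 : Fin 5) ≠ 2 by decide), mul_zero, mul_one, zero_add, add_zero]
  push_cast
  rw [h3]
  ring

/-- `∂f/∂t = 5t⁴` (`= t⁴` in characteristic 2). [folklore] -/
theorem pderiv_three_f (k : Type) [Field k] [CharP k 2] (f : MvPolynomial (Fin 5) k)
    (hf : f = X 4 ^ 2 + X 0 ^ 2 * X 4 + X 1 ^ 3 + X 2 ^ 3 + X 3 ^ 5) : pderiv 3 f = X 3 ^ 4 := by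
  have h5 := P2d4F5Specimen.five_eq_one k
  rw [hf]
  simp only [map_add, Derivation.leibniz, pderiv_pow, pderiv_X_self, smul_eq_mul, pderiv_X_of_ne (show (4 : Fin 5) ≠ 3 by decide),
    pderiv_X_of_ne (show (0 : Fin 5) ≠ 3 by decide), pderiv_X_of_ne (show (1 : Fin 5) ≠ 3 by decide),
    pderiv_X_of_ne (show (2 : Fin 5) ≠ 3 by decide), mul_zero, mul_one, zero_add, add_zero]
  push_cast
  rw [h5]
  ring

/-- `f` has no constant term. [folklore] -/
theorem constantCoeff_f (k : Type) [Field k] (f : MvPolynomial (Fin 5) k)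
    (hf : f = X 4 ^ 2 + X 0 ^ 2 * X 4 + X 1 ^ 3 + X 2 ^ 3 + X 3 ^ 5) : constantCoeff f = 0 := by
  rw [hf]
  simp [constantCoeff_X]

/-- **`f = z² + x²z + y³ + u³ + t⁵` is PRIME in characteristic 2**: as `T² + C(x²)·T + C(y³ + u³ + t⁵)` over `k[x, y, u, t]` (`z ↦ T`), Eisenstein-type at
the point `(0, 1, 1, 0)` where `x² = 0`, `y³ + u³ + t⁵ = 2 = 0` and `∂/∂y = 3y² = 1 ≠ 0` (`irreducible_X_pow_add_C_mul_X_add_C`). [folklore] -/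
theorem prime_f (k : Type) [Field k] [CharP k 2] (f : MvPolynomial (Fin 5) k)
    (hf : f = X 4 ^ 2 + X 0 ^ 2 * X 4 + X 1 ^ 3 + X 2 ^ 3 + X 3 ^ 5) : Prime f := by
  set e : MvPolynomial (Fin 5) k ≃+* Polynomial (MvPolynomial (Fin 4) k) :=
    ((renameEquiv k (_root_.finRotate 5)).trans (finSuccEquiv k 4)).toRingEquiv with he_def
  have hrot4 : (_root_.finRotate 5) (4 : Fin 5) = 0 := by decide
  have hrot : ∀ j : Fin 4, (_root_.finRotate 5) (Fin.castSucc j) = j.succ := by decide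
  have he4 : e (X 4) = Polynomial.X := by
    show finSuccEquiv k 4 (rename _ (X 4)) = _
    rw [rename_X, hrot4]; exact finSuccEquiv_X_zero
  have hej : ∀ j : Fin 4, e (X (Fin.castSucc j)) = Polynomial.C (X j) := fun j => by
    show finSuccEquiv k 4 (rename _ (X (Fin.castSucc j))) = _
    rw [rename_X, hrot j]; exact finSuccEquiv_X_succ (j := j)
  set b : MvPolynomial (Fin 4) k := X 0 ^ 2 with hb
  set c : MvPolynomial (Fin 4) k := X 1 ^ 3 + X 2 ^ 3 + X 3 ^ 5 with hc
  have hef : e f = Polynomial.X ^ 2 + Polynomial.C b * Polynomial.X + Polynomial.C c := by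
    rw [hf, map_add, map_add, map_add, map_add, map_pow, map_mul, map_pow, he4, map_pow, map_pow, map_pow,
      show (0 : Fin 5) = Fin.castSucc (0 : Fin 4) from rfl, show (1 : Fin 5) = Fin.castSucc (1 : Fin 4) from rfl,
      show (2 : Fin 5) = Fin.castSucc (2 : Fin 4) from rfl, show (3 : Fin 5) = Fin.castSucc (3 : Fin 4) from rfl, hej, hej, hej, hej, hb, hc]
    simp only [map_add, map_pow]
    ring
  set a : Fin 4 → k := ![0, 1, 1, 0] with ha
  have h2 : (2 : k) = 0 := by simpa using CharP.cast_eq_zero k 2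
  have h5 : (5 : k) = 1 := by
    calc (5 : k) = 2 * 2 + 1 := by norm_num
      _ = 1 := by rw [h2]; ring
  have hba : MvPolynomial.eval a b = 0 := by rw [hb, map_pow, eval_X, ha]; simp
  have h3 : (3 : k) = 1 := by
    calc (3 : k) = 2 + 1 := by norm_num
      _ = 1 := by rw [h2]; ring
  have hca : MvPolynomial.eval a c = 0 := by
    rw [hc]
    simp only [map_add, map_pow, eval_X, ha, Matrix.cons_val_zero, Matrix.cons_val_one]
    simp only [Matrix.cons_val, one_pow, zero_pow (by norm_num : (5 : ℕ) ≠ 0), add_zero]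
    rw [show (1 : k) + 1 = 2 by norm_num, h2]
  have hder : MvPolynomial.eval a (pderiv 1 c) ≠ 0 := by
    have e1 : pderiv 1 c = 3 * X 1 ^ 2 := by
      rw [hc, map_add, map_add, pderiv_pow, pderiv_X_self, pderiv_pow, pderiv_X_of_ne (show (2 : Fin 4) ≠ 1 by decide),
        pderiv_pow, pderiv_X_of_ne (show (3 : Fin 4) ≠ 1 by decide)]
      push_cast
      ring
    rw [e1, map_mul, map_pow, eval_X, ha]
    simp only [Matrix.cons_val_one, Matrix.cons_val_zero, one_pow, mul_one]
    rw [map_ofNat, h3]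
    exact one_ne_zero
  have hirr : Irreducible (e f) := by
    rw [hef]
    exact Literature.AlgebraicGeometry.Motives.SmoothHypersurface.irreducible_X_pow_add_C_mul_X_add_C (d := 2) le_rfl b c a hba hca 1 hder
  exact (MulEquiv.prime_iff e).mp hirr.prime

/-- **`(k[X]/(f))_P` is regular at every prime `P ⊉ (x̄, ȳ, ū, t̄, z̄)`**: some variable misses `P`; `y, u, t ∉ P` ⇒ Jacobian with `∂ = y², u², t⁴`; `x ∉ P`
⇒ Jacobian with `∂_z f = x²`; and `z` cannot be the only one outside `P` (`z² = f − x²z − Σ ∈ P`). [cite: Hartshorne1977, I Thm. 5.1] -/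
theorem regular_off_vertex (k : Type) [Field k] [CharP k 2] (f : MvPolynomial (Fin 5) k)
    (hf : f = X 4 ^ 2 + X 0 ^ 2 * X 4 + X 1 ^ 3 + X 2 ^ 3 + X 3 ^ 5)
    (P : Ideal (MvPolynomial (Fin 5) k ⧸ Ideal.span {f})) [P.IsPrime]
    (hP : ¬ Ideal.span (Set.range fun j : Fin 5 => Ideal.Quotient.mk (Ideal.span {f}) (X j)) ≤ P) :
    IsRegularLocalRing (Localization.AtPrime P) := by
  have hP' : (P.comap (Ideal.Quotient.mk (Ideal.span {f}))).IsPrime := Ideal.comap_isPrime _ _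
  set P' := P.comap (Ideal.Quotient.mk (Ideal.span {f})) with hP'def
  have hex : ∃ j : Fin 5, j ≠ 4 ∧ (X j : MvPolynomial (Fin 5) k) ∉ P' := by
    by_contra hall
    push Not at hall
    apply hP
    rw [Ideal.span_le]
    rintro _ ⟨j, rfl⟩
    change X j ∈ P'
    by_cases hj : j = 4
    · subst hj
      have hfP : f ∈ P' := FermatCubicConeChar2.self_mem_comap f P
      have hx : (X 0 : MvPolynomial (Fin 5) k) ∈ P' := hall 0 (by decide)
      have hy : (X 1 : MvPolynomial (Fin 5) k) ∈ P' := hall 1 (by decide)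
      have hu : (X 2 : MvPolynomial (Fin 5) k) ∈ P' := hall 2 (by decide)
      have ht : (X 3 : MvPolynomial (Fin 5) k) ∈ P' := hall 3 (by decide)
      have hz2 : (X 4 : MvPolynomial (Fin 5) k) ^ 2 ∈ P' := by
        have e : (X 4 : MvPolynomial (Fin 5) k) ^ 2 = f - (X 0 ^ 2 * X 4 + X 1 ^ 3 + X 2 ^ 3 + X 3 ^ 5) := by rw [hf]; ring
        rw [e]
        refine Ideal.sub_mem _ hfP (Ideal.add_mem _ (Ideal.add_mem _ (Ideal.add_mem _ ?_ ?_) ?_) ?_)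
        · exact Ideal.mul_mem_right _ _ (Ideal.pow_mem_of_mem _ hx 2 (by norm_num))
        · exact Ideal.pow_mem_of_mem _ hy 3 (by norm_num)
        · exact Ideal.pow_mem_of_mem _ hu 3 (by norm_num)
        · exact Ideal.pow_mem_of_mem _ ht 5 (by norm_num)
      exact hP'.mem_of_pow_mem 2 hz2
    · exact hall j hj
  obtain ⟨j, hj4, hj⟩ := hex
  by_cases hj0 : j = 0
  · subst hj0
    exact HypersurfaceRegular.stub_hypersurfaceRegularOfPderiv k 5 f 4 P
      (by rw [pderiv_four_f k f hf]; exact fun h => hj (hP'.mem_of_pow_mem 2 h))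
  · by_cases hj1 : j = 1
    · subst hj1
      exact HypersurfaceRegular.stub_hypersurfaceRegularOfPderiv k 5 f 1 P
        (by rw [pderiv_one_f k f hf]; exact fun h => hj (hP'.mem_of_pow_mem 2 h))
    by_cases hj2 : j = 2
    · subst hj2
      exact HypersurfaceRegular.stub_hypersurfaceRegularOfPderiv k 5 f 2 P
        (by rw [pderiv_two_f k f hf]; exact fun h => hj (hP'.mem_of_pow_mem 2 h))
    · have hj3 : j = 3 := by fin_cases j <;> simp_all
      subst hj3
      exact HypersurfaceRegular.stub_hypersurfaceRegularOfPderiv k 5 f 3 P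
        (by rw [pderiv_three_f k f hf]; exact fun h => hj (hP'.mem_of_pow_mem 4 h))

/-- `X` is integral. [folklore] -/
theorem isIntegral_p2d4b (k : Type) [Field k] [CharP k 2] (f : MvPolynomial (Fin 5) k)
    (hf : f = X 4 ^ 2 + X 0 ^ 2 * X 4 + X 1 ^ 3 + X 2 ^ 3 + X 3 ^ 5) :
    IsIntegral (Spec (.of (MvPolynomial (Fin 5) k ⧸ Ideal.span {f}))) := by
  haveI := (Ideal.span_singleton_prime (prime_f k f hf).ne_zero).mpr (prime_f k f hf)
  haveI : IsDomain (MvPolynomial (Fin 5) k ⧸ Ideal.span {f}) := Ideal.Quotient.isDomain _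
  infer_instance

/-! ## §2 The binders at the vertex -/

/-- (H1) the vertex is closed. [folklore] -/
theorem isClosed_vertex (k : Type) [Field k] (f : MvPolynomial (Fin 5) k)
    (hf : f = X 4 ^ 2 + X 0 ^ 2 * X 4 + X 1 ^ 3 + X 2 ^ 3 + X 3 ^ 5)
    (v : Spec (.of (MvPolynomial (Fin 5) k ⧸ Ideal.span {f})))
    (hv : v.asIdeal = Ideal.span (Set.range fun j : Fin 5 => Ideal.Quotient.mk (Ideal.span {f}) (X j))) :
    IsClosed ({v} : Set (Spec (.of (MvPolynomial (Fin 5) k ⧸ Ideal.span {f})))) :=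
  DoublePointFermatCubicGerm.isClosed_origin k f (constantCoeff_f k f hf) v hv

/-- (H2) the vertex is NOT regular: `f(0) = 0`, `∇f(0) = 0`. [cite: Hartshorne1977, I Thm. 5.1] -/
theorem vertex_not_mem_regularLocus (k : Type) [Field k] [CharP k 2] (f : MvPolynomial (Fin 5) k)
    (hf : f = X 4 ^ 2 + X 0 ^ 2 * X 4 + X 1 ^ 3 + X 2 ^ 3 + X 3 ^ 5)
    (v : Spec (.of (MvPolynomial (Fin 5) k ⧸ Ideal.span {f})))
    (hv : v.asIdeal = Ideal.span (Set.range fun j : Fin 5 => Ideal.Quotient.mk (Ideal.span {f}) (X j))) :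
    v ∉ Scheme.regularLocus (Spec (.of (MvPolynomial (Fin 5) k ⧸ Ideal.span {f}))) := by
  classical
  refine not_mem_regularLocus_Spec_of_not_isRegularLocalRing v ?_
  refine not_isRegularLocalRing_localization_of_pderiv_eval_eq_zero (0 : Fin 5 → k) (prime_f k f hf).ne_zero ?_ ?_ v.asIdeal ?_
  · rw [MvPolynomial.eval_zero]
    exact constantCoeff_f k f hf
  · intro i
    by_cases hi4 : i = 4
    · subst hi4
      rw [pderiv_four_f k f hf, map_pow, MvPolynomial.eval_X, Pi.zero_apply, zero_pow two_ne_zero]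
    by_cases hi0 : i = 0
    · subst hi0
      rw [hf]
      simp only [map_add, Derivation.leibniz, pderiv_pow, pderiv_X_self, smul_eq_mul, map_mul, map_pow, map_natCast,
        MvPolynomial.eval_X, Pi.zero_apply, pderiv_X_of_ne (show (4 : Fin 5) ≠ 0 by decide),
        pderiv_X_of_ne (show (1 : Fin 5) ≠ 0 by decide), pderiv_X_of_ne (show (2 : Fin 5) ≠ 0 by decide),
        pderiv_X_of_ne (show (3 : Fin 5) ≠ 0 by decide)]
      simp
    by_cases hi1 : i = 1
    · subst hi1
      rw [pderiv_one_f k f hf, map_pow, MvPolynomial.eval_X, Pi.zero_apply, zero_pow two_ne_zero]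
    by_cases hi2 : i = 2
    · subst hi2
      rw [pderiv_two_f k f hf, map_pow, MvPolynomial.eval_X, Pi.zero_apply, zero_pow two_ne_zero]
    · have hi : i = 3 := by fin_cases i <;> simp_all
      subst hi
      rw [pderiv_three_f k f hf, map_pow, MvPolynomial.eval_X, Pi.zero_apply, zero_pow four_ne_zero]
  · rw [hv, DoublePointFermatCubicGerm.comap_origin k f (constantCoeff_f k f hf), MvPolynomial.eval_zero, Fedder.span_range_X_eq_ker]

/-- (H3) `dim 𝒪_{X,v} = 4`. [cite: Matsumura1987, Thm. 13.5] -/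
theorem ringKrullDim_stalk_vertex (k : Type) [Field k] [CharP k 2] (f : MvPolynomial (Fin 5) k)
    (hf : f = X 4 ^ 2 + X 0 ^ 2 * X 4 + X 1 ^ 3 + X 2 ^ 3 + X 3 ^ 5)
    (v : Spec (.of (MvPolynomial (Fin 5) k ⧸ Ideal.span {f})))
    (hv : v.asIdeal = Ideal.span (Set.range fun j : Fin 5 => Ideal.Quotient.mk (Ideal.span {f}) (X j))) :
    ringKrullDim ((Spec (.of (MvPolynomial (Fin 5) k ⧸ Ideal.span {f}))).presheaf.stalk v) = (4 : ℕ) := by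
  haveI : v.asIdeal.IsMaximal := by
    rw [hv]
    exact DoublePointFermatCubicGerm.isMaximal_origin k f (constantCoeff_f k f hf)
  rw [ringKrullDim_stalk_Spec_eq]
  exact HypersurfaceLocalDim.stub_hypersurfaceLocalDim k 4 f (prime_f k f hf).ne_zero v.asIdeal

/-- `X` is regular at every point other than the vertex. [cite: Hartshorne1977, I Thm. 5.1] -/
theorem regular_of_ne_vertex (k : Type) [Field k] [CharP k 2] (f : MvPolynomial (Fin 5) k)
    (hf : f = X 4 ^ 2 + X 0 ^ 2 * X 4 + X 1 ^ 3 + X 2 ^ 3 + X 3 ^ 5)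
    (v : Spec (.of (MvPolynomial (Fin 5) k ⧸ Ideal.span {f})))
    (hv : v.asIdeal = Ideal.span (Set.range fun j : Fin 5 => Ideal.Quotient.mk (Ideal.span {f}) (X j))) :
    ∀ y : Spec (.of (MvPolynomial (Fin 5) k ⧸ Ideal.span {f})), y ⤳ v → y ≠ v →
      y ∈ Scheme.regularLocus (Spec (.of (MvPolynomial (Fin 5) k ⧸ Ideal.span {f}))) := by
  intro y hy hne
  refine FermatCubicConeGerm.mem_regularLocus_Spec_of_isRegularLocalRing y (regular_off_vertex k f hf y.asIdeal fun hle => hne ?_)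
  have h2 : y.asIdeal ≤ v.asIdeal := (PrimeSpectrum.le_iff_specializes y v).mpr hy
  exact PrimeSpectrum.ext (le_antisymm h2 (hv ▸ hle))

/-- (H4) ISOLATED: `Spec 𝒪_{X,v}` is regular off its closed point. [cite: Temkin2008, §2.1] -/
theorem regular_off_closedPoint_vertex (k : Type) [Field k] [CharP k 2] (f : MvPolynomial (Fin 5) k)
    (hf : f = X 4 ^ 2 + X 0 ^ 2 * X 4 + X 1 ^ 3 + X 2 ^ 3 + X 3 ^ 5)
    (v : Spec (.of (MvPolynomial (Fin 5) k ⧸ Ideal.span {f})))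
    (hv : v.asIdeal = Ideal.span (Set.range fun j : Fin 5 => Ideal.Quotient.mk (Ideal.span {f}) (X j))) :
    ∀ s : Spec ((Spec (.of (MvPolynomial (Fin 5) k ⧸ Ideal.span {f}))).presheaf.stalk v),
      s ≠ closedPoint _ → s ∈ Scheme.regularLocus (Spec ((Spec (.of (MvPolynomial (Fin 5) k ⧸ Ideal.span {f}))).presheaf.stalk v)) :=
  regularLocus_Spec_stalk_of_isolated v (regular_of_ne_vertex k f hf v hv)

/-- (H5) the CM-clause at every point of `Spec 𝒪_{X,v}`. [cite: Matsumura1987, Thm. 17.4 and Thm. 17.8] -/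
theorem cmCl_Spec_stalk_vertex (k : Type) [Field k] [CharP k 2] (f : MvPolynomial (Fin 5) k)
    (hf : f = X 4 ^ 2 + X 0 ^ 2 * X 4 + X 1 ^ 3 + X 2 ^ 3 + X 3 ^ 5)
    (v : Spec (.of (MvPolynomial (Fin 5) k ⧸ Ideal.span {f})))
    (hv : v.asIdeal = Ideal.span (Set.range fun j : Fin 5 => Ideal.Quotient.mk (Ideal.span {f}) (X j))) :
    ∀ s : Spec ((Spec (.of (MvPolynomial (Fin 5) k ⧸ Ideal.span {f}))).presheaf.stalk v),
      CMCl ((Spec ((Spec (.of (MvPolynomial (Fin 5) k ⧸ Ideal.span {f}))).presheaf.stalk v)).presheaf.stalk s) :=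
  cmCl_Spec_stalk_of_isolated v (cmCl_stalk_Spec_of_cmCl_localization v
    (DoublePointFermatCubicGerm.cmCl_localization_hypersurface k f (prime_f k f hf).ne_zero v)) (regular_of_ne_vertex k f hf v hv)

/-! ## §3 The vertex is a BAD point -/

/-- ★ **The vertex of P2d4B is NOT FULL**: `f = z·z + x²·z + y²·y + u²·u + t²·t³ ∈ 𝔪^{[2]}` (Fedder necessity,
`HypersurfaceOriginNotFull.not_fullCl_stalk_origin_of_fedder_mem`). [cite: Fedder1983, Prop. 1.7] -/
theorem p2d4b_vertex_not_fullCl (k : Type) [Field k] [CharP k 2] (f : MvPolynomial (Fin 5) k)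
    (hf : f = X 4 ^ 2 + X 0 ^ 2 * X 4 + X 1 ^ 3 + X 2 ^ 3 + X 3 ^ 5)
    (v : Spec (.of (MvPolynomial (Fin 5) k ⧸ Ideal.span {f})))
    (hv : v.asIdeal = Ideal.span (Set.range fun j : Fin 5 => Ideal.Quotient.mk (Ideal.span {f}) (X j))) :
    ¬ FullCl 2 ((Spec (.of (MvPolynomial (Fin 5) k ⧸ Ideal.span {f}))).presheaf.stalk v) := by
  haveI : Fact (Nat.Prime 2) := ⟨Nat.prime_two⟩
  refine HypersurfaceOriginNotFull.not_fullCl_stalk_origin_of_fedder_mem 2 k f (prime_f k f hf).ne_zero (constantCoeff_f k f hf) ?_ v hv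
  rw [show (2 - 1 : ℕ) = 1 from rfl, pow_one, hf]
  have hsq : ∀ j : Fin 5, (X j : MvPolynomial (Fin 5) k) ^ 2 ∈ Ideal.span (Set.range fun i : Fin 5 => (X i : MvPolynomial (Fin 5) k) ^ 2) :=
    fun j => Ideal.subset_span ⟨j, rfl⟩
  refine Ideal.add_mem _ (Ideal.add_mem _ (Ideal.add_mem _ (Ideal.add_mem _ (hsq 4) ?_) ?_) ?_) ?_
  · exact Ideal.mul_mem_right _ _ (hsq 0)
  · rw [pow_succ]
    exact Ideal.mul_mem_right _ _ (hsq 1)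
  · rw [pow_succ]
    exact Ideal.mul_mem_right _ _ (hsq 2)
  · rw [show (X 3 : MvPolynomial (Fin 5) k) ^ 5 = X 3 ^ 2 * X 3 ^ 3 by ring]
    exact Ideal.mul_mem_right _ _ (hsq 3)

end Summit.ResolutionOfSingularities.ResolutionOfSingularities.Theorems.FInjectiveMacaulayfication.P2d4BSpecimen

end
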